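import Summits.KontsevichZagierPeriods.Zeta5Search.Zudilin2002Minors
import Summits.KontsevichZagierPeriods.Zeta5Search.WedgeDictionaryPFTransfer
import HarnessLib

/-!
# ζ(5) search — row 7, input (B): the partner contiguity of Zudilin's coefficient vectors, certified (cell `pub-zeta5`)

HONEST FRAMING: systematic search; no irrationality claim unless certified.

OUR work (Summit side; lead/lit g3, `HOME/pub-zeta5-lit-g3/CONTIGUITY-CERT.md`). We DISCHARGE the hypothesis `Contig` of
`Zudilin2002Minors` for the three pairs `(uC, utC)`, `(wC, wtC)`, `(vC, vtC)` of `Literature/…/Zudilin2002/WellPoisedForms`: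
`b₀(n)·x̃ₙ = −196n⁵·xₙ₋₁ + cB(n)·xₙ − 87(n+1)⁵·xₙ₊₁` (`n ≥ 1`). For `n ≥ 2` this is the transfer to partial-fraction
coefficients of a creative-telescoping identity between the summands,
`b₀(n)R̃ₙ(t) + 196n⁵Rₙ₋₁(t) − cB(n)Rₙ(t) + 87(n+1)⁵Rₙ₊₁(t) = G(t+1) − G(t)`,
`G(t) = −h(n,t)·n!⁴(t−n+1)ₙ(t+n+2)ₙ₋₂/(t+1)ₙ₊₁⁶` with an explicit polynomial `h` of bidegree `(8, 8)` (found by the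
cell by exact linear algebra and interpolation; here CERTIFIED: the polynomial identity `gosper_contig3` is closed by
`ring`), followed by P1's transfer bookkeeping (`WedgeDictionaryPFTransfer`: padding, shift, `pf_unique`); the harmonic
functional `v` transfers too because ALL coefficients of the telescoped data vanish and `G(0) = 0`. For `n = 1` the
relation is checked from the explicit values at `n ≤ 2`.
Result: `contig_uC : Contig uC utC`, `contig_wC : Contig wC wtC`, `contig_vC : Contig vC vtC`.
-/

noncomputable section

open Finset Polynomial

namespace Summit.KontsevichZagierPeriods.Zeta5Search.Zudilin2002Minors

open Literature.NumberTheory.Irrationality.Zudilin2002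
open Literature.NumberTheory.Transcendental.BallRivoal (pfEval pf_unique poch pochPoly eval_pochPoly poch_pos harm R)
open Literature.NumberTheory.Irrationality.CressonFischlerRivoal2008 (exists_pf_data)
open Summit.KontsevichZagierPeriods.Zeta5Search.WedgeDictionary (padData shiftUp pfEval_padData pfEval_shiftUp
  sum_padData sum_shiftUp poch_succ_right poch_succ_left)

/-! ### The certificate polynomial `h(n,t)` and the Gosper identity -/

/-- The certificate polynomial `h(n,t)` (bidegree `(8,8)`), found by the cell. -/
def hC (n t : ℚ) : ℚ :=
  49 * t ^ 8 + 49 * (11 * n + 7) * t ^ 7 - (15121 * n ^ 2 + 7408 * n + 813) / 2 * t ^ 6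
    - (73861 * n ^ 3 + 103464 * n ^ 2 + 45027 * n + 6898) * t ^ 5
    - (n + 1) * (513985 * n ^ 3 + 634606 * n ^ 2 + 261524 * n + 38591) / 2 * t ^ 4
    - (n + 1) ^ 2 * (932870 * n ^ 3 + 1009603 * n ^ 2 + 376913 * n + 50142) / 2 * t ^ 3
    - (n + 1) ^ 3 * (476825 * n ^ 3 + 451230 * n ^ 2 + 146757 * n + 16187) * t ^ 2
    - (n + 1) ^ 4 * (262972 * n ^ 3 + 216175 * n ^ 2 + 57641 * n + 4214) * t
    - 34 * n * (n + 1) ^ 5 * (1811 * n ^ 2 + 1273 * n + 245)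

/-- `cB` at a rational argument. -/
def cBq (n : ℚ) : ℚ := 3 * (10130 * n ^ 5 + 19198 * n ^ 4 + 16675 * n ^ 3 + 8207 * n ^ 2 + 2233 * n + 261)

/-- **The Gosper identity behind the contiguity** (a polynomial identity in `n, t`):
`h(t+1)(t+1)⁷(t+2n) − h(t)(t−n+1)(t+n+2)⁷ + 196n(t+(n+1)/2)(t+n+1)⁷(t+n+2)⁷
  − (t+1+n/2)(t−n+1)(t+2n)(t+2n+1)(t+n+2)⁷·[cB(n) + b₀(n)(t+1)(t+1+n)] + 87(n+1)⁹(t+(n+3)/2)(t−n)(t−n+1)(t+2n)(t+2n+1)(t+2n+2)(t+2n+3) = 0`. -/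
theorem gosper_contig3 (n t : ℚ) :
    hC n (t + 1) * (t + 1) ^ 7 * (t + 2 * n) - hC n t * (t - n + 1) * (t + n + 2) ^ 7
      + 196 * n * (t + (n + 1) / 2) * (t + n + 1) ^ 7 * (t + n + 2) ^ 7
      - (t + 1 + n / 2) * (t - n + 1) * (t + 2 * n) * (t + 2 * n + 1) * (t + n + 2) ^ 7
          * (cBq n + b₀ n * ((t + 1) * (t + 1 + n)))
      + 87 * (n + 1) ^ 9 * (t + (n + 3) / 2) * (t - n) * (t - n + 1) * (t + 2 * n) * (t + 2 * n + 1)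
          * (t + 2 * n + 2) * (t + 2 * n + 3) = 0 := by
  unfold hC cBq b₀ a₀; ring

/-- `h(n,·)` as a polynomial in `t`. -/
def hPoly (n : ℚ) : ℚ[X] :=
  C 49 * X ^ 8 + C (49 * (11 * n + 7)) * X ^ 7 + C (-((15121 * n ^ 2 + 7408 * n + 813) / 2)) * X ^ 6
    + C (-(73861 * n ^ 3 + 103464 * n ^ 2 + 45027 * n + 6898)) * X ^ 5
    + C (-((n + 1) * (513985 * n ^ 3 + 634606 * n ^ 2 + 261524 * n + 38591) / 2)) * X ^ 4
    + C (-((n + 1) ^ 2 * (932870 * n ^ 3 + 1009603 * n ^ 2 + 376913 * n + 50142) / 2)) * X ^ 3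
    + C (-((n + 1) ^ 3 * (476825 * n ^ 3 + 451230 * n ^ 2 + 146757 * n + 16187))) * X ^ 2
    + C (-((n + 1) ^ 4 * (262972 * n ^ 3 + 216175 * n ^ 2 + 57641 * n + 4214))) * X
    + C (-(34 * n * (n + 1) ^ 5 * (1811 * n ^ 2 + 1273 * n + 245)))

/-- `eval` of `hPoly`. -/
theorem eval_hPoly (n t : ℚ) : (hPoly n).eval t = hC n t := by
  simp only [hPoly, hC, eval_add, eval_mul, eval_C, eval_X, eval_pow]; ring

/-- `deg h ≤ 8`. -/
theorem natDegree_hPoly_le (n : ℚ) : (hPoly n).natDegree ≤ 8 := by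
  unfold hPoly; compute_degree

/-- `deg (t+β)_k ≤ k`. -/
private theorem natDegree_pochPoly_le (β : ℚ) (k : ℕ) : (pochPoly β k).natDegree ≤ k := by
  unfold pochPoly
  refine (natDegree_prod_le _ _).trans ?_
  refine (sum_le_sum fun s _ => (natDegree_X_add_C _).le).trans ?_
  simp

/-- The numerator of the certificate `G` at `n = m + 2`: `−(m+2)!⁴ · h(m+2, t) · (t−m−1)_{m+2} · (t+m+4)_m`. -/
def gPoly (m : ℕ) : ℚ[X] :=
  C (-(((m + 2).factorial : ℚ) ^ 4)) * hPoly ((m : ℚ) + 2) * (pochPoly (-(m : ℚ) - 1) (m + 2) * pochPoly ((m : ℚ) + 4) m)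

/-- `eval` of `gPoly`. -/
theorem eval_gPoly (m : ℕ) (t : ℚ) : (gPoly m).eval t =
    -(((m + 2).factorial : ℚ) ^ 4) * hC ((m : ℚ) + 2) t
      * (poch (t + (-(m : ℚ) - 1)) (m + 2) * poch (t + ((m : ℚ) + 4)) m) := by
  simp only [gPoly, eval_mul, eval_C, eval_hPoly, eval_pochPoly]

/-- `deg gPoly m ≤ 2m + 10`. -/
theorem natDegree_gPoly_le (m : ℕ) : (gPoly m).natDegree ≤ 2 * m + 10 := by
  unfold gPoly
  refine natDegree_mul_le.trans ?_
  have h1 : (C (-(((m + 2).factorial : ℚ) ^ 4)) * hPoly ((m : ℚ) + 2)).natDegree ≤ 8 :=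
    (natDegree_C_mul_le _ _).trans (natDegree_hPoly_le _)
  have h2 : (pochPoly (-(m : ℚ) - 1) (m + 2) * pochPoly ((m : ℚ) + 4) m).natDegree ≤ (m + 2) + m :=
    natDegree_mul_le.trans (add_le_add (natDegree_pochPoly_le _ _) (natDegree_pochPoly_le _ _))
  omega

/-- Partial-fraction data of `G = gPoly m/((t+1)_{m+3})⁶` exist (degree `2m+10 < 6(m+3)`). -/
theorem exists_pf_gPoly (m : ℕ) : ∃ d : ℕ → ℕ → ℚ, ∀ t : ℚ, (∀ p, p ≤ m + 2 → t + p + 1 ≠ 0) →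
    pfEval (m + 2) 6 d t = (gPoly m).eval t / poch (t + 1) (m + 3) ^ 6 := by
  have hdeg : (gPoly m).degree < ((6 * (m + 2 + 1) : ℕ) : WithBot ℕ) :=
    (degree_le_of_natDegree_le (natDegree_gPoly_le m)).trans_lt (by exact_mod_cast (by omega))
  obtain ⟨d, hd⟩ := exists_pf_data (m + 2) 6 (by norm_num) (gPoly m) hdeg
  exact ⟨d, fun t ht => by rw [hd t ht]⟩

/-! ### Pochhammer bookkeeping at `n = m + 2` -/

/-- `R_{n-1}(t)` over the base quantities `Z = (t−m)_{m+1}`, `Y = (t+m+4)_m`, `P = (t+1)_{m+2}`. -/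
theorem R_prev_eq (m : ℕ) (t : ℚ) : R 6 1 (m + 1) t =
    (((m + 1).factorial : ℚ)) ^ 4 * poch (t - m) (m + 1) * ((t + m + 3) * poch (t + m + 4) m)
      / poch (t + 1) (m + 2) ^ 6 := by
  rw [R_six_one_eq]
  have e1 : poch (t + ((m + 1 : ℕ) : ℚ) + 2) (m + 1) = (t + m + 3) * poch (t + m + 4) m := by
    rw [poch_succ_left]; push_cast; ring_nf
  rw [e1]; push_cast; ring_nf

/-- `R_n(t)`, `n = m+2`, over the base quantities. -/
theorem R_cur_eq (m : ℕ) (t : ℚ) : R 6 1 (m + 2) t =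
    (((m + 1).factorial : ℚ)) ^ 4 * ((m : ℚ) + 2) ^ 4 * ((t - m - 1) * poch (t - m) (m + 1))
      * (poch (t + m + 4) m * (t + 2 * m + 4) * (t + 2 * m + 5)) / (poch (t + 1) (m + 2) * (t + m + 3)) ^ 6 := by
  rw [R_six_one_eq]
  have e1 : poch (t - ((m + 2 : ℕ) : ℚ) + 1) (m + 2) = (t - m - 1) * poch (t - m) (m + 1) := by
    rw [poch_succ_left]; push_cast; ring_nf
  have e2 : poch (t + ((m + 2 : ℕ) : ℚ) + 2) (m + 2) = poch (t + m + 4) m * (t + 2 * m + 4) * (t + 2 * m + 5) := by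
    rw [poch_succ_right, poch_succ_right]; push_cast; ring_nf
  have e3 : poch (t + 1) (m + 2 + 1) = poch (t + 1) (m + 2) * (t + m + 3) := by
    rw [poch_succ_right]; push_cast; ring_nf
  have e4 : (((m + 2).factorial : ℕ) : ℚ) = ((m : ℚ) + 2) * ((m + 1).factorial : ℕ) := by
    rw [Nat.factorial_succ]; push_cast; ring
  rw [e1, e2, e3, e4]; ring

/-- `R_{n+1}(t)`, `n = m+2`, over the base quantities (needs `t + m + 4 ≠ 0`). -/
theorem R_next_eq (m : ℕ) (t : ℚ) (h4 : t + m + 4 ≠ 0) : R 6 1 (m + 3) t =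
    (((m + 1).factorial : ℚ)) ^ 4 * ((m : ℚ) + 2) ^ 4 * ((m : ℚ) + 3) ^ 4
      * ((t - m - 2) * (t - m - 1) * poch (t - m) (m + 1))
      * (poch (t + m + 4) m * (t + 2 * m + 4) * (t + 2 * m + 5) * (t + 2 * m + 6) * (t + 2 * m + 7) / (t + m + 4))
      / (poch (t + 1) (m + 2) * (t + m + 3) * (t + m + 4)) ^ 6 := by
  rw [R_six_one_eq]
  have e1 : poch (t - ((m + 3 : ℕ) : ℚ) + 1) (m + 3) = (t - m - 2) * (t - m - 1) * poch (t - m) (m + 1) := by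
    rw [poch_succ_left, poch_succ_left]; push_cast; ring_nf
  have e2 : poch (t + ((m + 3 : ℕ) : ℚ) + 2) (m + 3) * (t + m + 4) =
      poch (t + m + 4) m * (t + 2 * m + 4) * (t + 2 * m + 5) * (t + 2 * m + 6) * (t + 2 * m + 7) := by
    have : poch (t + m + 4) (m + 4) = (t + m + 4) * poch (t + ((m + 3 : ℕ) : ℚ) + 2) (m + 3) := by
      rw [poch_succ_left]; push_cast; ring_nf
    rw [mul_comm, ← this, poch_succ_right, poch_succ_right, poch_succ_right, poch_succ_right]; push_cast; ring
  have e2' : poch (t + ((m + 3 : ℕ) : ℚ) + 2) (m + 3) =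
      poch (t + m + 4) m * (t + 2 * m + 4) * (t + 2 * m + 5) * (t + 2 * m + 6) * (t + 2 * m + 7) / (t + m + 4) := by
    rw [← e2, mul_div_cancel_right₀ _ h4]
  have e3 : poch (t + 1) (m + 3 + 1) = poch (t + 1) (m + 2) * (t + m + 3) * (t + m + 4) := by
    rw [poch_succ_right, poch_succ_right]; push_cast; ring_nf
  have e4 : (((m + 3).factorial : ℕ) : ℚ) = ((m : ℚ) + 3) * ((m : ℚ) + 2) * ((m + 1).factorial : ℕ) := by
    rw [Nat.factorial_succ, Nat.factorial_succ]; push_cast; ring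
  rw [e1, e2', e3, e4]; ring

/-- `G(t)`, `n = m+2`, over the base quantities. -/
theorem G_cur_eq (m : ℕ) (t : ℚ) : (gPoly m).eval t / poch (t + 1) (m + 3) ^ 6 =
    -((((m + 1).factorial : ℚ)) ^ 4 * ((m : ℚ) + 2) ^ 4) * hC ((m : ℚ) + 2) t
      * ((t - m - 1) * poch (t - m) (m + 1)) * poch (t + m + 4) m / (poch (t + 1) (m + 2) * (t + m + 3)) ^ 6 := by
  rw [eval_gPoly]
  have e1 : poch (t + (-(m : ℚ) - 1)) (m + 2) = (t - m - 1) * poch (t - m) (m + 1) := by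
    rw [poch_succ_left]; ring_nf
  have e2 : poch (t + ((m : ℚ) + 4)) m = poch (t + m + 4) m := by ring_nf
  have e3 : poch (t + 1) (m + 3) = poch (t + 1) (m + 2) * (t + m + 3) := by
    rw [poch_succ_right]; push_cast; ring_nf
  have e4 : (((m + 2).factorial : ℕ) : ℚ) = ((m : ℚ) + 2) * ((m + 1).factorial : ℕ) := by
    rw [Nat.factorial_succ]; push_cast; ring
  rw [e1, e2, e3, e4]; ring

/-- `G(t+1)`, `n = m+2`, over the base quantities (needs `t + 1 ≠ 0`, `t + m + 4 ≠ 0`). -/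
theorem G_next_eq (m : ℕ) (t : ℚ) (h1 : t + 1 ≠ 0) (h4 : t + m + 4 ≠ 0) :
    (gPoly m).eval (t + 1) / poch (t + 1 + 1) (m + 3) ^ 6 =
    -((((m + 1).factorial : ℚ)) ^ 4 * ((m : ℚ) + 2) ^ 4) * hC ((m : ℚ) + 2) (t + 1)
      * (poch (t - m) (m + 1) * (t + 1)) * (poch (t + m + 4) m * (t + 2 * m + 4) / (t + m + 4))
      / (poch (t + 1) (m + 2) * (t + m + 3) * (t + m + 4) / (t + 1)) ^ 6 := by
  rw [eval_gPoly]
  have e1 : poch (t + 1 + (-(m : ℚ) - 1)) (m + 2) = poch (t - m) (m + 1) * (t + 1) := by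
    rw [poch_succ_right]; push_cast; ring_nf
  have e2 : poch (t + 1 + ((m : ℚ) + 4)) m * (t + m + 4) = poch (t + m + 4) m * (t + 2 * m + 4) := by
    have : poch (t + m + 4) (m + 1) = (t + m + 4) * poch (t + 1 + ((m : ℚ) + 4)) m := by
      rw [poch_succ_left]; ring_nf
    rw [mul_comm, ← this, poch_succ_right]; ring
  have e2' : poch (t + 1 + ((m : ℚ) + 4)) m = poch (t + m + 4) m * (t + 2 * m + 4) / (t + m + 4) := by
    rw [← e2, mul_div_cancel_right₀ _ h4]
  have e3 : poch (t + 1 + 1) (m + 3) * (t + 1) = poch (t + 1) (m + 2) * (t + m + 3) * (t + m + 4) := by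
    have : poch (t + 1) (m + 4) = (t + 1) * poch (t + 1 + 1) (m + 3) := by rw [poch_succ_left]
    rw [mul_comm, ← this, poch_succ_right, poch_succ_right]; push_cast; ring
  have e3' : poch (t + 1 + 1) (m + 3) = poch (t + 1) (m + 2) * (t + m + 3) * (t + m + 4) / (t + 1) := by
    rw [← e3, mul_div_cancel_right₀ _ h1]
  have e4 : (((m + 2).factorial : ℕ) : ℚ) = ((m : ℚ) + 2) * ((m + 1).factorial : ℕ) := by
    rw [Nat.factorial_succ]; push_cast; ring
  rw [e1, e2', e3', e4]; ring

/-! ### The telescoping identity at natural arguments -/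

/-- **The contiguity identity for the summands** at `t ∈ ℕ`, `n = m + 2`:
`b₀(n)R̃ₙ(t) + 196n⁵Rₙ₋₁(t) − cB(n)Rₙ(t) + 87(n+1)⁵Rₙ₊₁(t) + G(t) − G(t+1) = 0`
(the `R`'s carrying Zudilin's well-poised factor `t + 1 + n/2`, as in `IsDataR.pfEval_eq`). -/
theorem contig3_identity (m t : ℕ) :
    Q0 (m + 1) * (-(((t : ℚ) + 1) * ((t : ℚ) + 1 + ((m : ℚ) + 2))) * (((t : ℚ) + 1 + ((m : ℚ) + 2) / 2)
        * R 6 1 (m + 2) t))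
      + -QA (m + 1) * (((t : ℚ) + 1 + ((m : ℚ) + 1) / 2) * R 6 1 (m + 1) t)
      - QB (m + 1) * (((t : ℚ) + 1 + ((m : ℚ) + 2) / 2) * R 6 1 (m + 2) t)
      + -QC (m + 1) * (((t : ℚ) + 1 + ((m : ℚ) + 3) / 2) * R 6 1 (m + 3) t)
      + (gPoly m).eval (t : ℚ) / poch ((t : ℚ) + 1) (m + 3) ^ 6
      - (gPoly m).eval ((t : ℚ) + 1) / poch ((t : ℚ) + 1 + 1) (m + 3) ^ 6 = 0 := by
  have h1 : (t : ℚ) + 1 ≠ 0 := by positivity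
  have h3 : (t : ℚ) + m + 3 ≠ 0 := by positivity
  have h4 : (t : ℚ) + m + 4 ≠ 0 := by positivity
  have hP : poch ((t : ℚ) + 1) (m + 2) ≠ 0 := (poch_pos (by positivity) _).ne'
  have hF : (((m + 1).factorial : ℕ) : ℚ) ≠ 0 := by positivity
  rw [R_next_eq m _ h4, R_cur_eq m, R_prev_eq m, G_cur_eq m, G_next_eq m _ h1 h4]
  have h0 := congrArg (fun z => (((m + 1).factorial : ℕ) : ℚ) ^ 4 * ((m : ℚ) + 2) ^ 4 * poch ((t : ℚ) - m) (m + 1)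
    * poch ((t : ℚ) + m + 4) m / ((poch ((t : ℚ) + 1) (m + 2) * ((t : ℚ) + m + 3) * ((t : ℚ) + m + 4)) ^ 6
      * ((t : ℚ) + m + 4)) * z) (gosper_contig3 ((m : ℚ) + 2) (t : ℚ))
  simp only [mul_zero] at h0
  convert h0 using 1
  unfold Q0 QA QB QC cBq b₀ a₀
  push_cast
  field_simp
  ring

/-! ### Transfer bookkeeping -/

/-- `pfEval` of the six-term combination used below. -/
private theorem pfEval_comb6 (N K : ℕ) (a0 a1 a2 a3 : ℚ) (c0 c1 c2 c3 d d' : ℕ → ℕ → ℚ) (t : ℚ) :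
    pfEval N K (fun o p => a0 * c0 o p + a1 * c1 o p - a2 * c2 o p + a3 * c3 o p + d o p - d' o p) t =
      a0 * pfEval N K c0 t + a1 * pfEval N K c1 t - a2 * pfEval N K c2 t + a3 * pfEval N K c3 t
        + pfEval N K d t - pfEval N K d' t := by
  unfold pfEval
  simp only [add_div, sub_div, mul_div_assoc, sum_add_distrib, sum_sub_distrib, mul_sum]

/-- Weighted coefficient sums of padded data. -/
private theorem sum_padData_mul {N M : ℕ} (h : N ≤ M) (c : ℕ → ℕ → ℚ) (f : ℕ → ℚ) (o : ℕ) :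
    ∑ p ∈ range (M + 1), padData N c o p * f p = ∑ p ∈ range (N + 1), c o p * f p := by
  have hsub : range (N + 1) ⊆ range (M + 1) := range_subset_range.2 (by omega)
  rw [← sum_subset hsub]
  · exact sum_congr rfl fun p hp => by rw [padData, if_pos (Nat.lt_succ_iff.1 (mem_range.1 hp))]
  · intro p _ hp
    have hp' : ¬ p ≤ N := fun h' => hp (mem_range.2 (Nat.lt_succ_of_le h'))
    rw [padData, if_neg hp', zero_mul]

/-- Harmonic sums of shifted data: the shift `p ↦ p + 1` of the harmonic index costs `Σ_p c_{o,p}/(p+1)^{o+1}`. -/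
private theorem sum_shiftUp_harm (N : ℕ) (c : ℕ → ℕ → ℚ) (o : ℕ) :
    ∑ p ∈ range (N + 2), shiftUp c o p * harm (o + 1) p =
      ∑ p ∈ range (N + 1), c o p * harm (o + 1) p + ∑ p ∈ range (N + 1), c o p / ((p : ℚ) + 1) ^ (o + 1) := by
  rw [sum_range_succ', ← sum_add_distrib]
  simp only [shiftUp, if_true, zero_mul, add_zero, Nat.add_one_ne_zero, if_false, Nat.add_sub_cancel]
  refine sum_congr rfl fun p _ => ?_
  rw [harm, sum_range_succ, ← harm]
  ring

/-- `pfEval` at `t = 0` is the sum `Σ_o Σ_p c_{o,p}/(p+1)^{o+1}`. -/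
private theorem pfEval_zero_eq (N K : ℕ) (c : ℕ → ℕ → ℚ) :
    pfEval N K c 0 = ∑ o ∈ range K, ∑ p ∈ range (N + 1), c o p / ((p : ℚ) + 1) ^ (o + 1) := by
  unfold pfEval
  rw [sum_comm]
  simp

/-- `G(0) = 0`: the certificate numerator vanishes at `t = 0` (the factor `(t−m−1)_{m+2}` contains `t`). -/
theorem eval_gPoly_zero (m : ℕ) : (gPoly m).eval 0 = 0 := by
  rw [eval_gPoly]
  have : poch (0 + (-(m : ℚ) - 1)) (m + 2) = 0 := by
    rw [poch]
    exact prod_eq_zero (mem_range.2 (show m + 1 < m + 2 by omega)) (by push_cast; ring)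
  rw [this]; ring

/-! ### The transfer: the contiguity for `n ≥ 2` -/

/-- **The partner contiguity at every index `n = m + 2 ≥ 2`**, for `u, w, v` simultaneously (transfer of
`contig3_identity` to the partial-fraction coefficients; all coefficients of the telescoped data vanish by `pf_unique`,
and `G(0) = 0` kills the boundary term of the harmonic functional). -/
theorem contig_transfer (m : ℕ) :
    (Q0 (m + 1) * utC (m + 2) = QA (m + 1) * uC (m + 1) + QB (m + 1) * uC (m + 2) + QC (m + 1) * uC (m + 3)) ∧
    (Q0 (m + 1) * wtC (m + 2) = QA (m + 1) * wC (m + 1) + QB (m + 1) * wC (m + 2) + QC (m + 1) * wC (m + 3)) ∧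
    (Q0 (m + 1) * vtC (m + 2) = QA (m + 1) * vC (m + 1) + QB (m + 1) * vC (m + 2) + QC (m + 1) * vC (m + 3)) := by
  obtain ⟨d, hd⟩ := exists_pf_gPoly m
  set c' := dataRt (m + 2)
  set c0 := dataR (m + 1)
  set c1 := dataR (m + 2)
  set c2 := dataR (m + 3)
  set e : ℕ → ℕ → ℚ := fun o p => Q0 (m + 1) * padData (m + 2) c' o p + (-QA (m + 1)) * padData (m + 1) c0 o p
    - QB (m + 1) * padData (m + 2) c1 o p + (-QC (m + 1)) * c2 o p + padData (m + 2) d o p - shiftUp d o p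
    with he_def
  have he : ∀ t : ℕ, pfEval (m + 3) 6 e t = 0 := by
    intro t
    have ht : ∀ k p : ℕ, p ≤ k → (t : ℚ) + p + 1 ≠ 0 := fun k p _ => by positivity
    have ht1 : ∀ k p : ℕ, p ≤ k → (t : ℚ) + 1 + p + 1 ≠ 0 := fun k p _ => by positivity
    have hsh : pfEval (m + 3) 6 (shiftUp d) (t : ℚ) = pfEval (m + 2) 6 d ((t : ℚ) + 1) := pfEval_shiftUp (m + 2) 6 d t
    rw [he_def, pfEval_comb6, pfEval_padData (by omega), pfEval_padData (by omega), pfEval_padData (by omega),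
      pfEval_padData (by omega), hsh, (isDataRt_dataRt (m + 2)).pfEval_eq _ (ht _),
      (isDataR_dataR (m + 1)).pfEval_eq _ (ht _), (isDataR_dataR (m + 2)).pfEval_eq _ (ht _),
      (isDataR_dataR (m + 3)).pfEval_eq _ (ht _), hd _ (ht _), hd _ (ht1 _)]
    have := contig3_identity m t
    push_cast at this ⊢
    linear_combination this
  have hz : ∀ o p, o < 6 → p ≤ m + 3 → e o p = 0 := fun o p ho hp =>
    pf_unique (m + 3) 6 e 0 (fun t _ => he t) o p ho hp
  -- fixed-order coefficient sums
  have hsum : ∀ {o : ℕ}, o < 6 →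
      Q0 (m + 1) * ∑ p ∈ range (m + 3), c' o p + -QA (m + 1) * ∑ p ∈ range (m + 2), c0 o p
        - QB (m + 1) * ∑ p ∈ range (m + 3), c1 o p + -QC (m + 1) * ∑ p ∈ range (m + 4), c2 o p = 0 := by
    intro o ho
    have hz' : ∑ p ∈ range (m + 4), e o p = 0 :=
      sum_eq_zero fun p hp => hz o p ho (Nat.lt_succ_iff.1 (mem_range.1 hp))
    simp only [he_def, sum_add_distrib, sum_sub_distrib, ← mul_sum] at hz'
    rw [sum_padData (by omega), sum_padData (by omega), sum_padData (by omega), sum_padData (by omega),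
      show m + 4 = (m + 2) + 2 from rfl, sum_shiftUp] at hz'
    linear_combination hz'
  -- harmonic sums
  have hG0 : ∑ o ∈ range 6, ∑ p ∈ range (m + 3), d o p / ((p : ℚ) + 1) ^ (o + 1) = 0 := by
    rw [← pfEval_zero_eq, hd 0 (fun p _ => by positivity), eval_gPoly_zero, zero_div]
  have hharm :
      Q0 (m + 1) * ∑ o ∈ range 6, ∑ p ∈ range (m + 3), c' o p * harm (o + 1) p
        + -QA (m + 1) * ∑ o ∈ range 6, ∑ p ∈ range (m + 2), c0 o p * harm (o + 1) p
        - QB (m + 1) * ∑ o ∈ range 6, ∑ p ∈ range (m + 3), c1 o p * harm (o + 1) p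
        + -QC (m + 1) * ∑ o ∈ range 6, ∑ p ∈ range (m + 4), c2 o p * harm (o + 1) p = 0 := by
    have hz' : ∑ o ∈ range 6, ∑ p ∈ range (m + 4), e o p * harm (o + 1) p = 0 :=
      sum_eq_zero fun o ho => sum_eq_zero fun p hp => by
        rw [hz o p (mem_range.1 ho) (Nat.lt_succ_iff.1 (mem_range.1 hp)), zero_mul]
    simp only [he_def, add_mul, sub_mul, mul_assoc, sum_add_distrib, sum_sub_distrib, ← mul_sum] at hz'
    rw [show m + 4 = (m + 3) + 1 from rfl] at hz'
    simp only [sum_padData_mul (show m + 2 ≤ m + 3 by omega), sum_padData_mul (show m + 1 ≤ m + 3 by omega)] at hz'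
    rw [show m + 3 + 1 = (m + 2) + 2 from rfl] at hz'
    simp only [sum_shiftUp_harm, sum_add_distrib] at hz'
    rw [hG0] at hz'
    linear_combination hz'
  refine ⟨?_, ?_, ?_⟩
  · have h := hsum (show 4 < 6 by norm_num)
    simp only [uC, utC, c', c0, c1, c2] at h ⊢
    linear_combination h
  · have h := hsum (show 2 < 6 by norm_num)
    simp only [wC, wtC, c', c0, c1, c2] at h ⊢
    linear_combination h
  · simp only [vC, vtC, c', c0, c1, c2] at hharm ⊢
    linear_combination hharm

/-! ### The index `n = 1` from the explicit values, and the assembled contiguity -/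

/-- The contiguity at `n = 1` (`m = 0`), from the values at `n = 0, 1, 2` of `WellPoisedForms`. -/
theorem contig_one :
    (Q0 0 * utC 1 = QA 0 * uC 0 + QB 0 * uC 1 + QC 0 * uC 2) ∧
    (Q0 0 * wtC 1 = QA 0 * wC 0 + QB 0 * wC 1 + QC 0 * wC 2) ∧
    (Q0 0 * vtC 1 = QA 0 * vC 0 + QB 0 * vC 1 + QC 0 * vC 2) := by
  obtain ⟨g0u, g0w, g0v, g0ut, g0wt, g0vt⟩ := values_zero
  obtain ⟨g1u, g1w, g1v, g1ut, g1wt, g1vt⟩ := values_one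
  obtain ⟨g2u, g2w, g2v, g2ut, g2wt, g2vt⟩ := values_two
  simp only [Q0, QA, QB, QC, b₀, a₀, g0u, g0w, g0v, g1u, g1w, g1v, g1ut, g1wt, g1vt, g2u, g2w, g2v]
  norm_num

/-- **`Contig uC utC`**: the partner contiguity of the `ζ(5)`-coefficients, all `n ≥ 1`. -/
theorem contig_uC : Contig uC utC := fun m => by
  cases m with
  | zero => simpa using contig_one.1
  | succ m => simpa [add_assoc] using (contig_transfer m).1

/-- **`Contig wC wtC`**: the partner contiguity of the `ζ(3)`-coefficients, all `n ≥ 1`. -/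
theorem contig_wC : Contig wC wtC := fun m => by
  cases m with
  | zero => simpa using contig_one.2.1
  | succ m => simpa [add_assoc] using (contig_transfer m).2.1

/-- **`Contig vC vtC`**: the partner contiguity of the constant terms, all `n ≥ 1`. -/
theorem contig_vC : Contig vC vtC := fun m => by
  cases m with
  | zero => simpa using contig_one.2.2
  | succ m => simpa [add_assoc] using (contig_transfer m).2.2

/-! ### Consequence: row 7's limits from (8) alone -/

open Filter Topology in
open Literature.NumberTheory.Transcendental (zetaValue) in
/-- **Row 7 reduced to Zudilin's (8)**: if the coefficients `u, w, v` of `rₙ` satisfy the recursion (8) (`Rec8`, to be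
discharged from the cell's certified `t`-telescoper `SymRayGosper.gosper_symray`), then — the partner contiguity being
certified here and `Q_solvesRec` discharged in the tree — `pₙ/qₙ → ζ(5)` and `p̃ₙ/qₙ → ζ(3)`. -/
theorem tendsto_of_rec8 (hQ : Literature.NumberTheory.Irrationality.BrownZudilin2022.Q_solvesRec)
    (hu : Rec8 uC) (hw : Rec8 wC) (hv : Rec8 vC) :
    Tendsto (fun n : ℕ => (p n : ℝ) / q n) atTop (𝓝 (zetaValue 5)) ∧
      Tendsto (fun n : ℕ => (ptilde n : ℝ) / q n) atTop (𝓝 (zetaValue 3)) :=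
  tendsto_of_rec8_of_contig hQ hu hw hv contig_uC contig_wC contig_vC

/-- **The minors solve (1), given (8)**: `IsSolution minorQ ∧ IsSolution minorP ∧ IsSolution minorPt` from `Rec8`×3. -/
theorem minors_isSolution_of_rec8 (hu : Rec8 uC) (hw : Rec8 wC) (hv : Rec8 vC) :
    IsSolution minorQ ∧ IsSolution minorP ∧ IsSolution minorPt :=
  minors_isSolution hu hw hv contig_uC contig_wC contig_vC

end Summit.KontsevichZagierPeriods.Zeta5Search.Zudilin2002Minors
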